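import Literature.Topology.FourManifolds.ConnectedSumCohomology
import Literature.Topology.FourManifolds.ConnectedSumProofs
import Literature.Topology.FourManifolds.TopologicalConnectedSum
import HarnessLib

/-!
# Orienting a topological connected sum: the gluing maps are orientation preserving up to sign

Topic `Literature/Topology/FourManifolds`. Sequel of `TopologicalConnectedSumExistence.lean`
(existence of topological connected sums) towards the additivity `Q_{M # N} ≅ Q_M ⊥ Q_N` of the
intersection form for **topological** connected sums, which the tree has for smooth oriented
connected sums (`exists_isConnectedSum_intersectionForm_equivalent_prod`,
`SmoothIntersectionFormsRealisationDiagonal.lean`, through the smooth/homological dictionary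
`SmoothOrientation.IsCompatible`). The homological computation itself
(`ConnectedSumNeck.exists_decomposition_intersectionForm`, `ConnectedSumCohomology.lean`) is
already topological: it takes the gluing data `ConnectedSumNeck n M N P` (continuous injections
`i₁`, `i₂`, embeddings `jA`, `jB` with open ranges) and asks only that both gluing maps be
*homologically orientation preserving* (`IsOrientedLeft μM μP`, `IsOrientedRight μN μP`). This
file supplies that hypothesis WITHOUT smooth structures, up to the one sign that the topology of an
unoriented gluing cannot fix:

A. Hatcher, *Algebraic Topology* (2002), §3.3: local orientations are local (p. 231, excision
`Hₙ(U | x) ≅ Hₙ(M | x)`) and natural under homeomorphisms, and "if `M` is connected and orientable,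
it has exactly two orientations" (p. 234). Hence an open embedding `j : U → P` of a CONNECTED
oriented manifold `(U, μ)` into an oriented manifold `(P, μP)` carries `μ` either to `μP|_{j U}`
or to `-μP|_{j U}` — for the gluing map `jA : M ∖ {i₁ 0} → M # N` this is
`IsOrientedLeft μM μP ∨ IsOrientedLeft μM (-μP)` (M. Kervaire, J. Milnor, *Groups of homotopy
spheres I* (1963), §2, p. 505: with `i₁` orientation preserving and `i₂` orientation reversing
the sum is "oriented compatibly with `M₁` and `M₂`"; for arbitrary discs one of `N`, `-N` is the
compatible one).

## Main results (everything is proved; no definition, no named fact)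

* `IsTopConnectedSum.nonempty_connectedSumNeck` — the relational predicate `IsTopConnectedSum`
  (`TopologicalConnectedSum.lean`) yields the gluing data `ConnectedSumNeck` of the cohomology
  computation; `IsConnectedSum.isTopConnectedSum` — smooth connected sums (`ConnectedSum.lean`,
  Euclidean models) are topological connected sums.
* `HomologicalOrientation.restrictOpens_neg` — `(-μ)|_U = -(μ|_U)`.
* `ConnectedSumNeck.isOrientedLeft_or_neg` — for `M ∖ {i₁ 0}` connected and any orientations
  `μM`, `μP`: `IsOrientedLeft μM μP ∨ IsOrientedLeft μM (-μP)`; `isOrientedRight_or_neg` likewise.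
* `ConnectedSumNeck.isOrientedRight_neg_neg_iff` —
  `IsOrientedRight (-μN) (-μP) ↔ IsOrientedRight μN μP` (and the left version).
* `ConnectedSumNeck.exists_isOrientedLeft_isOrientedRight` — **given `μM`, `μN` and any
  orientation `μP₀` of the sum, there are an orientation `μP = ±μP₀` and a sign `ε` with
  `IsOrientedLeft μM μP ∧ IsOrientedRight (ε μN) μP`** (`ε μN ∈ {μN, -μN}`).
* `ConnectedSumNeck.exists_decomposition_intersectionForm_or` — hence, for closed connected
  `ℤ`-oriented `M`, `N` of dimension `k + k`, `k ≥ 2`, and a compact topological connected sum `P`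
  admitting some orientation: an orientation `μP` and `μN' ∈ {μN, -μN}` with
  `H^k(P)/T ≅ H^k(M)/T ⊕ H^k(N)/T` and `Q⟦μP⟧ (x, y) = Q⟦μM⟧ (sM x, sM y) + Q⟦μN'⟧ (sN x, sN y)`.

The sign `ε` is genuinely undetermined by unoriented gluing data (`ℂℙ² # ℂℙ²` and `ℂℙ² # (-ℂℙ²)`
are both topological connected sums of two copies of `ℂℙ²`); pinning it to `+1` by reflecting one
coordinate disc is left to the sequel.

## References

* A. Hatcher, *Algebraic Topology*, CUP 2002, §3.3 pp. 231–236. [HatcherAT2002]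
* M. Kervaire, J. Milnor, *Groups of homotopy spheres I*, Ann. of Math. 77 (1963), §2 p. 505.
  [KervaireMilnorAnnals1963]
* C. T. C. Wall, *On simply-connected 4-manifolds*, J. London Math. Soc. 39 (1964), §2
  pp. 144–145. [WallJLMS1964]
-/

open scoped Manifold Topology
open Set Function CategoryTheory TopologicalSpace Topology
open Literature.AlgebraicTopology.SingularHomology

noncomputable section

namespace Literature.AlgebraicTopology.SingularHomology

namespace HomologicalOrientation

variable {n : ℕ} {M : Type} [TopologicalSpace M] [T2Space M]
  [ChartedSpace (EuclideanSpace ℝ (Fin n)) M]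

/-- **Restriction to an open subset commutes with reversing the orientation**:
`(-μ)|_U = -(μ|_U)` (both have local class `-μₓ` after the excision isomorphism
`Hₙ(U | x) ≅ Hₙ(M | x)`; Hatcher 2002, §3.3 p. 231). [cite: HatcherAT2002, §3.3 p. 231] -/
theorem restrictOpens_neg (μ : HomologicalOrientation ℤ M n) (U : Opens M) :
    (-μ).restrictOpens U = -(μ.restrictOpens U) := by
  ext x
  haveI := localHomology.isIso_map_of_isOpenEmbedding_of_eq ℤ ℤ (valC U) (isOpenEmbedding_valC U)
    x rfl n
  apply (ModuleCat.mono_iff_injective (relativeSingularHomology.map ℤ ℤ (valC U)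
    (LocalFamily.mapsTo_compl_pt Subtype.val_injective x) n)).1 inferInstance
  rw [map_val_restrictOpens_localClass, neg_localClass, neg_localClass, map_neg,
    map_val_restrictOpens_localClass]

end HomologicalOrientation

end Literature.AlgebraicTopology.SingularHomology

namespace Literature.Topology.FourManifolds

/-! ### From the relational predicates to the gluing data -/

section Neck

variable {n : ℕ} {M N P : Type*} [TopologicalSpace M] [T2Space M] [TopologicalSpace N]
  [T2Space N] [TopologicalSpace P]

/-- **A topological connected sum carries the gluing data of `ConnectedSumCohomology.lean`**: the
discs and gluing maps of `IsTopConnectedSum` (open topological embeddings) are in particular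
continuous injections and embeddings with open ranges (Kervaire–Milnor 1963, §2).
[cite: KervaireMilnorAnnals1963, §2 p. 505] -/
theorem IsTopConnectedSum.nonempty_connectedSumNeck
    (h : IsTopConnectedSum (EuclideanSpace ℝ (Fin n)) M N P) :
    Nonempty (ConnectedSumNeck n M N P) := by
  obtain ⟨i₁, i₂, h₁, h₂, jA, jB, hA, hB, hU, hR⟩ := h
  exact ⟨{ i₁ := i₁, i₂ := i₂, jA := jA, jB := jB
           continuous_i₁ := h₁.continuous, injective_i₁ := h₁.injective
           continuous_i₂ := h₂.continuous, injective_i₂ := h₂.injective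
           isEmbedding_jA := hA.isEmbedding, isEmbedding_jB := hB.isEmbedding
           isOpen_range_jA := hA.isOpen_range, isOpen_range_jB := hB.isOpen_range
           union_range := hU, rel := hR }⟩

/-- **Smooth connected sums are topological connected sums** (for the Euclidean models of closed
`n`-manifolds): the smooth discs `ℝⁿ → M`, `ℝⁿ → N` have open range (an equidimensional immersion
is open, `isOpen_range_of_isImmersion_of_finrank_le`), and a smooth open gluing is a topological
one (`IsOpenGluing.isTopOpenGluing`) (Kervaire–Milnor 1963, §2; Kosinski VI.1).
[cite: KervaireMilnorAnnals1963, §2 p. 505] -/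
theorem IsConnectedSum.isTopConnectedSum [ChartedSpace (EuclideanSpace ℝ (Fin n)) M]
    [ChartedSpace (EuclideanSpace ℝ (Fin n)) N] [ChartedSpace (EuclideanSpace ℝ (Fin n)) P]
    (h : IsConnectedSum (𝓡 n) (𝓡 n) (𝓡 n) M N P) :
    IsTopConnectedSum (EuclideanSpace ℝ (Fin n)) M N P := by
  obtain ⟨i₁, i₂, h₁, h₂, hG⟩ := h
  exact ⟨i₁, i₂,
    ⟨h₁.isEmbedding, isOpen_range_of_isImmersion_of_finrank_le h₁.isImmersion le_rfl⟩,
    ⟨h₂.isEmbedding, isOpen_range_of_isImmersion_of_finrank_le h₂.isImmersion le_rfl⟩,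
    hG.isTopOpenGluing⟩

end Neck

namespace ConnectedSumNeck

/-! ### One gluing map: orientation preserving up to a global sign -/

section Left

variable {n : ℕ} {M N P : Type} [TopologicalSpace M] [T2Space M] [TopologicalSpace N]
  [T2Space N] [TopologicalSpace P] [T2Space P] (d : ConnectedSumNeck n M N P)
  [ChartedSpace (EuclideanSpace ℝ (Fin n)) M] [ChartedSpace (EuclideanSpace ℝ (Fin n)) P]

omit [T2Space P] [ChartedSpace (EuclideanSpace ℝ (Fin n)) M]
  [ChartedSpace (EuclideanSpace ℝ (Fin n)) P] in
/-- The gluing map `jA` is an open embedding (an embedding with open range). [folklore] -/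
theorem isOpenEmbedding_jA : IsOpenEmbedding d.jA := ⟨d.isEmbedding_jA, d.isOpen_range_jA⟩

omit [T2Space P] [ChartedSpace (EuclideanSpace ℝ (Fin n)) P] in
/-- Reversing the orientation of the sum reverses the predicate's right-hand side:
`IsOrientedLeft μM (-μP)` says `(jA)_* (μM|)ₐ = -(μP)_{jA a}`. [folklore] -/
theorem isOrientedLeft_neg_iff (μM : HomologicalOrientation ℤ M n)
    (μP : HomologicalOrientation ℤ P n) :
    d.IsOrientedLeft μM (-μP) ↔ ∀ a : puncture d.i₁, relativeSingularHomology.map ℤ ℤ d.jAC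
      (LocalFamily.mapsTo_compl_pt d.isEmbedding_jA.injective a) n
        ((μM.restrictOpens (puncture d.i₁)).localClass a) = -μP.localClass (d.jA a) :=
  Iff.rfl

omit [T2Space P] [ChartedSpace (EuclideanSpace ℝ (Fin n)) P] in
/-- Reversing both orientations does not change the predicate. [folklore] -/
theorem isOrientedLeft_neg_neg_iff (μM : HomologicalOrientation ℤ M n)
    (μP : HomologicalOrientation ℤ P n) :
    d.IsOrientedLeft (-μM) (-μP) ↔ d.IsOrientedLeft μM μP := by
  simp only [IsOrientedLeft, HomologicalOrientation.restrictOpens_neg,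
    HomologicalOrientation.neg_localClass, map_neg, neg_inj]

/-- **The gluing map `jA : M ∖ {i₁ 0} → M # N` is orientation preserving for `μP` or for `-μP`.**
For the open piece `U = M ∖ {i₁ 0}` connected and arbitrary `ℤ`-orientations `μM` of `M`, `μP` of
`P`: transport `μP|_{range jA}` back along the homeomorphism `U ≅ range jA`; the result is an
orientation of the connected manifold `U`, hence equals `μM|_U` or `-(μM|_U)` (Hatcher 2002, §3.3
p. 234, two orientations of a connected manifold; p. 231, naturality of local orientations under
homeomorphisms and restriction to open subsets). [cite: HatcherAT2002, §3.3 pp. 231, 234] -/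
theorem isOrientedLeft_or_neg [ConnectedSpace (puncture d.i₁)] (μM : HomologicalOrientation ℤ M n)
    (μP : HomologicalOrientation ℤ P n) :
    d.IsOrientedLeft μM μP ∨ d.IsOrientedLeft μM (-μP) := by
  -- the open pieces `U = M ∖ {i₁ 0}` and `V = range jA`, and `e : U ≃ₜ V`
  set U : Opens M := puncture d.i₁ with hU
  let V : Opens P := ⟨range d.jA, d.isOpen_range_jA⟩
  let e : U ≃ₜ V := d.isEmbedding_jA.toHomeomorph
  have he : ∀ a : U, ((e a : V) : P) = d.jA a := fun a => rfl
  -- the transported orientation of `U`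
  let ν : HomologicalOrientation ℤ U n := (μP.restrictOpens V).comap e
  -- `jA = val ∘ e` as continuous maps
  have hfac : d.jAC = (HomologicalOrientation.valC V).comp (e : C(U, V)) := by
    ext a
    rfl
  -- the key computation: `(jA)_* νₐ = (μP)_{jA a}`
  have key : ∀ a : U, relativeSingularHomology.map ℤ ℤ d.jAC
      (LocalFamily.mapsTo_compl_pt d.isEmbedding_jA.injective a) n (ν.localClass a) =
        μP.localClass (d.jA a) := by
    intro a
    have hea : MapsTo (e : C(U, V)) ({a}ᶜ : Set U) ({e a}ᶜ : Set V) :=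
      LocalFamily.mapsTo_compl_pt e.injective a
    have hva : MapsTo (HomologicalOrientation.valC V) ({e a}ᶜ : Set V) ({d.jA a}ᶜ : Set P) :=
      LocalFamily.mapsTo_compl_pt Subtype.val_injective (e a)
    rw [relativeSingularHomology.map_congr_left ℤ ℤ hfac _ (hva.comp hea) n,
      relativeSingularHomology.map_comp ℤ ℤ (e : C(U, V)) (HomologicalOrientation.valC V) hea hva n,
      ModuleCat.comp_apply]
    have h1 : relativeSingularHomology.map ℤ ℤ (e : C(U, V)) hea n (ν.localClass a) =
        (μP.restrictOpens V).localClass (e a) := by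
      change (localHomology.mapIso ℤ ℤ e a n).hom
        ((localHomology.mapIso ℤ ℤ e a n).inv ((μP.restrictOpens V).localClass (e a))) = _
      rw [← ModuleCat.comp_apply, Iso.inv_hom_id, ModuleCat.id_apply]
    rw [h1]
    exact HomologicalOrientation.map_val_restrictOpens_localClass μP V (e a)
  -- two orientations of the connected `U`
  rcases HomologicalOrientation.eq_or_eq_neg_of_connected_holds U (μM.restrictOpens U) ν with h | h
  · left
    intro a
    rw [h]
    exact key a
  · right
    intro a
    rw [h, HomologicalOrientation.neg_localClass, map_neg, key a,
      HomologicalOrientation.neg_localClass]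

end Left

/-! ### The second gluing map, by symmetry -/

section Right

variable {n : ℕ} {M N P : Type} [TopologicalSpace M] [T2Space M] [TopologicalSpace N]
  [T2Space N] [TopologicalSpace P] [T2Space P] (d : ConnectedSumNeck n M N P)
  [ChartedSpace (EuclideanSpace ℝ (Fin n)) N] [ChartedSpace (EuclideanSpace ℝ (Fin n)) P]

omit [T2Space P] [ChartedSpace (EuclideanSpace ℝ (Fin n)) P] in
/-- Reversing both orientations does not change `IsOrientedRight`. [folklore] -/
theorem isOrientedRight_neg_neg_iff (μN : HomologicalOrientation ℤ N n)
    (μP : HomologicalOrientation ℤ P n) :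
    d.IsOrientedRight (-μN) (-μP) ↔ d.IsOrientedRight μN μP :=
  d.swap.isOrientedLeft_neg_neg_iff μN μP

/-- **The gluing map `jB : N ∖ {i₂ 0} → M # N` is orientation preserving for `μP` or for `-μP`**
(the left statement for the swapped data). [cite: HatcherAT2002, §3.3 pp. 231, 234] -/
theorem isOrientedRight_or_neg [ConnectedSpace (puncture d.i₂)] (μN : HomologicalOrientation ℤ N n)
    (μP : HomologicalOrientation ℤ P n) :
    d.IsOrientedRight μN μP ∨ d.IsOrientedRight μN (-μP) :=
  haveI : ConnectedSpace (puncture d.swap.i₁) := ‹ConnectedSpace (puncture d.i₂)›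
  d.swap.isOrientedLeft_or_neg μN μP

end Right

/-! ### Both gluing maps: an orientation of the sum compatible with `μM` and with `±μN` -/

section Both

variable {n : ℕ} {M N P : Type} [TopologicalSpace M] [T2Space M] [TopologicalSpace N]
  [T2Space N] [TopologicalSpace P] [T2Space P] (d : ConnectedSumNeck n M N P)
  [ChartedSpace (EuclideanSpace ℝ (Fin n)) M] [ChartedSpace (EuclideanSpace ℝ (Fin n)) N]
  [ChartedSpace (EuclideanSpace ℝ (Fin n)) P]

/-- **Orienting a topological connected sum.** For orientations `μM`, `μN` of the summands and
ANY orientation `μP₀` of a topological connected sum `P` whose open pieces `M ∖ {i₁ 0}`,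
`N ∖ {i₂ 0}` are connected, there are an orientation `μP ∈ {μP₀, -μP₀}` of `P` and a sign
`ε = ±1` such that `jA` is orientation preserving from `(M, μM)` and `jB` from `(N, ε μN)`
(Kervaire–Milnor 1963, §2 p. 505: the connected sum of oriented manifolds is oriented compatibly
with both summands once the second disc is chosen orientation reversing; for arbitrary discs the
compatible orientation of the second summand is `μN` or `-μN`).
[cite: KervaireMilnorAnnals1963, §2 p. 505] -/
theorem exists_isOrientedLeft_isOrientedRight [ConnectedSpace (puncture d.i₁)]
    [ConnectedSpace (puncture d.i₂)] (μM : HomologicalOrientation ℤ M n)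
    (μN : HomologicalOrientation ℤ N n) (μP₀ : HomologicalOrientation ℤ P n) :
    ∃ (μP : HomologicalOrientation ℤ P n) (μN' : HomologicalOrientation ℤ N n),
      (μP = μP₀ ∨ μP = -μP₀) ∧ (μN' = μN ∨ μN' = -μN) ∧
        d.IsOrientedLeft μM μP ∧ d.IsOrientedRight μN' μP := by
  -- orient `P` compatibly with `μM`
  obtain ⟨μP, hP, hL⟩ : ∃ μP : HomologicalOrientation ℤ P n, (μP = μP₀ ∨ μP = -μP₀) ∧
      d.IsOrientedLeft μM μP := by
    rcases d.isOrientedLeft_or_neg μM μP₀ with h | h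
    · exact ⟨μP₀, Or.inl rfl, h⟩
    · exact ⟨-μP₀, Or.inr rfl, h⟩
  -- then `jB` preserves `μN` or `-μN`
  rcases d.isOrientedRight_or_neg μN μP with h | h
  · exact ⟨μP, μN, hP, Or.inl rfl, hL, h⟩
  · refine ⟨μP, -μN, hP, Or.inr rfl, hL, ?_⟩
    rw [← d.isOrientedRight_neg_neg_iff, neg_neg]
    exact h

end Both

/-! ### The intersection form of a topological connected sum, up to the sign of `N` -/

section Form

variable {m : ℕ} {M N P : Type} [TopologicalSpace M] [T2Space M] [TopologicalSpace N]
  [T2Space N] [TopologicalSpace P] [T2Space P] (d : ConnectedSumNeck (m + 1) M N P)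
  [CompactSpace M] [CompactSpace N] [ChartedSpace (EuclideanSpace ℝ (Fin (m + 1))) M]
  [ChartedSpace (EuclideanSpace ℝ (Fin (m + 1))) N] [CompactSpace P]
  [ChartedSpace (EuclideanSpace ℝ (Fin (m + 1))) P]

/-- **`H^k(M # N)/T ≅ H^k(M)/T ⊕ H^k(N)/T` with `Q_{M # N} ≅ Q_M ⊥ Q_{±N}`, for a topological
connected sum.** For closed connected `ℤ`-oriented `M`, `N` of dimension `n = k + k`, `k ≥ 2`,
gluing data `d` of a compact topological connected sum `P` with connected open pieces, and any
orientation `μP₀` of `P`: there are an orientation `μP = ±μP₀`, an orientation `μN' = ±μN`, and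
linear maps `sM`, `sN` — the components of the inverse of `(a, b) ↦ c_M^* a + c_N^* b` — with
`x ↦ (sM x, sN x)` bijective and `Q⟦μP⟧ (x, y) = Q⟦μM⟧ (sM x, sM y) + Q⟦μN'⟧ (sN x, sN y)`
(Wall 1964, pp. 144–145; Kirby 1989, II §1; Milnor–Husemoller 1973, §V.1 — the tree's
`exists_decomposition_intersectionForm` fed with `exists_isOrientedLeft_isOrientedRight`).
[cite: WallJLMS1964, §2 pp. 144–145] [cite: KervaireMilnorAnnals1963, §2 p. 505] -/
theorem exists_decomposition_intersectionForm_or [ConnectedSpace M] [ConnectedSpace N]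
    [ConnectedSpace (puncture d.i₁)] [ConnectedSpace (puncture d.i₂)] (hm : 1 ≤ m)
    {k : ℕ} (hk : 2 ≤ k) (h : k + k = m + 1)
    (μM : HomologicalOrientation ℤ M (m + 1)) (μN : HomologicalOrientation ℤ N (m + 1))
    (μP₀ : HomologicalOrientation ℤ P (m + 1)) :
    ∃ (μP : HomologicalOrientation ℤ P (m + 1)) (μN' : HomologicalOrientation ℤ N (m + 1))
      (sM : ↥(freeCohomology ℤ P k) →ₗ[ℤ] ↥(freeCohomology ℤ M k))
      (sN : ↥(freeCohomology ℤ P k) →ₗ[ℤ] ↥(freeCohomology ℤ N k)),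
      (μP = μP₀ ∨ μP = -μP₀) ∧ (μN' = μN ∨ μN' = -μN) ∧
      Bijective (fun x => (sM x, sN x)) ∧
      ∀ x y, intersectionForm h μP x y =
        intersectionForm h μM (sM x) (sM y) + intersectionForm h μN' (sN x) (sN y) := by
  obtain ⟨μP, μN', hP, hN, hL, hR⟩ := d.exists_isOrientedLeft_isOrientedRight μM μN μP₀
  obtain ⟨sM, sN, -, -, -, hbij, hQ⟩ := d.exists_decomposition_intersectionForm hm hk h hL hR
  exact ⟨μP, μN', sM, sN, hP, hN, hbij, hQ⟩

end Form

end ConnectedSumNeck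

end Literature.Topology.FourManifolds
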